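import Summits.ResolutionOfSingularities.ResolutionOfSingularities.Theorems.FrobeniusLadderFInjectiveMacaulayficationCylinderOfPointModel
import Summits.ResolutionOfSingularities.ResolutionOfSingularities.Theorems.FrobeniusLadderFInjectiveMacaulayficationLocallyFixableCore
import Mathlib.Algebra.MvPolynomial.Equiv
import Mathlib.RingTheory.Polynomial.Basic
import HarnessLib

/-!
# THE CYLINDER PRODUCER IN DIMENSION `m` (R11.11 S6 / pool item W4.5a U5): a point model `Bl_I X₀` good at every stalk ⟹
# `Bl_{I·R[X₁,…,X_m]}` good at every stalk, and a STRONG⁺ confined iso-step for `X₀ × 𝔸^m` along `V(I) × 𝔸^m`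
# (crux `FInjectiveMacaulayfication` stmt-ResolutionOfSingularities-15315, chain w45a, hole #3;
# res-L1-w45a-plan-1 R12.14 (c); owner res-D-pv-017 AS res-L1-w45a-stub-5)

Support file for crux stmt-ResolutionOfSingularities-15315 (`FrobeniusLadder.FInjectiveMacaulayfication`), chain w45a.
[OURS · L1 W4.5a] — NOT a statement of any manuscript; AI-written, weaker than expert review.

* `affineBlowup_fiClause_of_bijective` — «every stalk of `Bl_I` is a domain with the clause» moves along a bijective ring map
  `φ : R → R'` to `Bl_{φ(I)}` (`LocallyFixable.exists_stalk_ringEquiv_of_bijective` of `…LocallyFixableCore`, stub-1).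
* `affineBlowup_fiClause_mvPolynomial` — `R` a Noetherian domain of characteristic `p`: if every stalk of `Bl_I(R)` is a domain
  satisfying the crux's clause then so is every stalk of `Bl_{I·R[X_{Fin m}]}(R[X_{Fin m}]) = Bl_I × 𝔸^m`, for every `m`
  (induction: `AffineBlowupPolynomial.affineBlowup_fiClause_polynomial` (S4) along `R[X_{Fin m}] → R[X_{Fin m}][t]`, then
  transport along `finSuccEquiv : R[X_{Fin (m+1)}] ≃ R[X_{Fin m}][t]`, `finSuccEquiv_comp_C_eq_C`; base case along the bijection
  `C : R → R[X_{Fin 0}]`). Every residue field, no separability.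
* `strongPlusStep_cylinder_of_pointModel_fin` (+ `_of_radical_eq`) — the STRONG⁺ ∃-clause of the hole-#3 stub
  `stub_confinedIsoStepStrongPlus` VERBATIM for `X₁ = Spec R[X_{Fin m}]` at every point `η` with `V(η) = V(I·R[X_{Fin m}])`
  (e.g. the generic point of `V(I) × 𝔸^m` when `√(I·R[X_{Fin m}])` is prime), realised by `Bl_I × 𝔸^m`
  (`StrongPlusStepOfAffineBlowup.strongPlusStep_of_affineBlowup`, p499685). `m = 1` is `CylinderOfPointModel` (S5, p516353) up to
  `R[X_{Fin 1}] ≅ R[t]`.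
No definitions, no named facts. [folklore]
-/

-- single-problem summit: the doubled namespace component is forced
set_option linter.dupNamespace false

noncomputable section

open AlgebraicGeometry CategoryTheory Literature.AlgebraicGeometry.Resolution

namespace Summit.ResolutionOfSingularities.ResolutionOfSingularities.Theorems.FInjectiveMacaulayfication.CylinderOfPointModelFin

open Summit.ResolutionOfSingularities.ResolutionOfSingularities.Theorems.FInjectiveMacaulayfication

/-! ## §1 Transport along ring isomorphisms -/

/-- **«`Bl_I` good at every stalk» moves along a bijective ring map** `φ : R → R'` to `Bl_{φ(I)}`: every stalk of
`Bl_{φ(I)}(Spec R')` is isomorphic to a stalk of `Bl_I(Spec R)` (`LocallyFixable.exists_stalk_ringEquiv_of_bijective`).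
[folklore] -/
theorem affineBlowup_fiClause_of_bijective (p : ℕ) {R R' : Type} [CommRing R] [CommRing R'] (φ : R →+* R')
    (hφ : Function.Bijective φ) (I : Ideal R)
    (hBl : ∀ y : ↥(affineBlowup I), IsDomain ((affineBlowup I).presheaf.stalk y) ∧
      ∀ d : ℕ, ringKrullDim ((affineBlowup I).presheaf.stalk y) = d →
        ∀ s : Fin d → (affineBlowup I).presheaf.stalk y, (Ideal.span (Set.range s)).radical.IsMaximal →
          RingTheory.Sequence.IsWeaklyRegular ((affineBlowup I).presheaf.stalk y) (List.ofFn s) ∧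
          ∀ z : (affineBlowup I).presheaf.stalk y, (∃ e : ℕ, z ^ p ^ e ∈
              Ideal.span ((fun w : (affineBlowup I).presheaf.stalk y => w ^ p ^ e) ''
                (Ideal.span (Set.range s) : Set ((affineBlowup I).presheaf.stalk y)))) →
            z ∈ Ideal.span (Set.range s)) :
    ∀ y : ↥(affineBlowup (I.map φ)), IsDomain ((affineBlowup (I.map φ)).presheaf.stalk y) ∧
      ∀ d : ℕ, ringKrullDim ((affineBlowup (I.map φ)).presheaf.stalk y) = d →
        ∀ s : Fin d → (affineBlowup (I.map φ)).presheaf.stalk y, (Ideal.span (Set.range s)).radical.IsMaximal →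
          RingTheory.Sequence.IsWeaklyRegular ((affineBlowup (I.map φ)).presheaf.stalk y) (List.ofFn s) ∧
          ∀ z : (affineBlowup (I.map φ)).presheaf.stalk y, (∃ e : ℕ, z ^ p ^ e ∈
              Ideal.span ((fun w : (affineBlowup (I.map φ)).presheaf.stalk y => w ^ p ^ e) ''
                (Ideal.span (Set.range s) : Set ((affineBlowup (I.map φ)).presheaf.stalk y)))) →
            z ∈ Ideal.span (Set.range s) := by
  intro y'
  obtain ⟨y, -, ⟨e⟩⟩ := LocallyFixable.exists_stalk_ringEquiv_of_bijective φ hφ I y'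
  obtain ⟨hdom, hcl⟩ := hBl y
  haveI := hdom
  exact ⟨MulEquiv.isDomain ((affineBlowup I).presheaf.stalk y) e.toMulEquiv,
    DegreeZeroDescent.inlineClause_of_ringEquiv (L := (affineBlowup I).presheaf.stalk y)
      (L' := (affineBlowup (I.map φ)).presheaf.stalk y') p e.symm hcl⟩

/-! ## §2 `Bl_I` good at every stalk ⟹ `Bl_{I·R[X₁,…,X_m]}` good at every stalk -/

/-- `finSuccEquiv⁻¹ ∘ C ∘ C = C`: the constants of `R[X_{Fin m}][t]` and of `R[X_{Fin (m+1)}]` correspond, on ideals. [folklore] -/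
theorem map_map_map_finSuccEquiv_symm {R : Type} [CommRing R] (I : Ideal R) (m : ℕ) :
    ((I.map (MvPolynomial.C : R →+* MvPolynomial (Fin m) R)).map
        (Polynomial.C : MvPolynomial (Fin m) R →+* Polynomial (MvPolynomial (Fin m) R))).map
      ((MvPolynomial.finSuccEquiv R m).symm : Polynomial (MvPolynomial (Fin m) R) →+* MvPolynomial (Fin (m + 1)) R) =
    I.map (MvPolynomial.C : R →+* MvPolynomial (Fin (m + 1)) R) := by
  rw [Ideal.map_map, Ideal.map_map, RingHom.comp_assoc, MvPolynomial.finSuccEquiv_comp_C_eq_C]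

set_option maxHeartbeats 800000 in
/-- **`Bl_I(R)` good at all stalks ⟹ `Bl_{I·R[X_{Fin m}]}(R[X_{Fin m}])` good at all stalks, every `m`** (`R` Noetherian domain of
characteristic `p`; the full clause: domain ∧ every system of parameters weakly regular ∧ parameter ideals Frobenius closed).
Induction on `m` with the one-variable step `AffineBlowupPolynomial.affineBlowup_fiClause_polynomial` (S4) and transport along
`finSuccEquiv` / the bijection `C : R → R[X_{Fin 0}]`. Every residue field. [folklore] -/
theorem affineBlowup_fiClause_mvPolynomial (p : ℕ) [Fact p.Prime] (R : Type) [CommRing R] [IsDomain R] [IsNoetherianRing R]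
    [CharP R p] (I : Ideal R)
    (hBl : ∀ y : ↥(affineBlowup I), IsDomain ((affineBlowup I).presheaf.stalk y) ∧
      ∀ d : ℕ, ringKrullDim ((affineBlowup I).presheaf.stalk y) = d →
        ∀ s : Fin d → (affineBlowup I).presheaf.stalk y, (Ideal.span (Set.range s)).radical.IsMaximal →
          RingTheory.Sequence.IsWeaklyRegular ((affineBlowup I).presheaf.stalk y) (List.ofFn s) ∧
          ∀ z : (affineBlowup I).presheaf.stalk y, (∃ e : ℕ, z ^ p ^ e ∈
              Ideal.span ((fun w : (affineBlowup I).presheaf.stalk y => w ^ p ^ e) ''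
                (Ideal.span (Set.range s) : Set ((affineBlowup I).presheaf.stalk y)))) →
            z ∈ Ideal.span (Set.range s)) (m : ℕ) :
    ∀ y : ↥(affineBlowup (I.map (MvPolynomial.C : R →+* MvPolynomial (Fin m) R))),
      IsDomain ((affineBlowup (I.map (MvPolynomial.C : R →+* MvPolynomial (Fin m) R))).presheaf.stalk y) ∧
      ∀ d : ℕ, ringKrullDim ((affineBlowup (I.map (MvPolynomial.C : R →+* MvPolynomial (Fin m) R))).presheaf.stalk y) = d →
        ∀ s : Fin d → (affineBlowup (I.map (MvPolynomial.C : R →+* MvPolynomial (Fin m) R))).presheaf.stalk y,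
          (Ideal.span (Set.range s)).radical.IsMaximal →
          RingTheory.Sequence.IsWeaklyRegular
            ((affineBlowup (I.map (MvPolynomial.C : R →+* MvPolynomial (Fin m) R))).presheaf.stalk y) (List.ofFn s) ∧
          ∀ z : (affineBlowup (I.map (MvPolynomial.C : R →+* MvPolynomial (Fin m) R))).presheaf.stalk y, (∃ e : ℕ, z ^ p ^ e ∈
              Ideal.span ((fun w : (affineBlowup (I.map (MvPolynomial.C : R →+* MvPolynomial (Fin m) R))).presheaf.stalk y =>
                w ^ p ^ e) '' (Ideal.span (Set.range s) :
                  Set ((affineBlowup (I.map (MvPolynomial.C : R →+* MvPolynomial (Fin m) R))).presheaf.stalk y)))) →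
            z ∈ Ideal.span (Set.range s) := by
  induction m with
  | zero =>
    -- `C : R → R[X_{Fin 0}]` is a bijection
    have hφ : Function.Bijective (MvPolynomial.C : R →+* MvPolynomial (Fin 0) R) := by
      have h : ((MvPolynomial.isEmptyRingEquiv R (Fin 0)).symm : R → MvPolynomial (Fin 0) R) =
          (MvPolynomial.C : R →+* MvPolynomial (Fin 0) R) :=
        funext fun r => MvPolynomial.isEmptyRingEquiv_symm_apply R (Fin 0) r
      rw [← h]
      exact (MvPolynomial.isEmptyRingEquiv R (Fin 0)).symm.bijective
    exact affineBlowup_fiClause_of_bijective p (MvPolynomial.C : R →+* MvPolynomial (Fin 0) R) hφ I hBl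
  | succ m ih =>
    -- the one-variable step over `R[X_{Fin m}]`, then transport along `finSuccEquiv⁻¹ : R[X_{Fin m}][t] → R[X_{Fin (m+1)}]`
    have h₁ := AffineBlowupPolynomial.affineBlowup_fiClause_polynomial p (MvPolynomial (Fin m) R)
      (I.map (MvPolynomial.C : R →+* MvPolynomial (Fin m) R)) ih
    have hφ : Function.Bijective
        ((MvPolynomial.finSuccEquiv R m).symm : Polynomial (MvPolynomial (Fin m) R) →+* MvPolynomial (Fin (m + 1)) R) :=
      (MvPolynomial.finSuccEquiv R m).symm.bijective
    have h₂ := affineBlowup_fiClause_of_bijective p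
      ((MvPolynomial.finSuccEquiv R m).symm : Polynomial (MvPolynomial (Fin m) R) →+* MvPolynomial (Fin (m + 1)) R) hφ _ h₁
    rw [map_map_map_finSuccEquiv_symm] at h₂
    exact h₂

/-! ## §3 The producer for `X₀ × 𝔸^m` -/

/-- **THE CYLINDER PRODUCER IN DIMENSION `m`.** `R` Noetherian domain of characteristic `p`, `I ≠ 0` with `Bl_I(R)` a domain
satisfying the clause at every stalk, `η` a point of `Spec R[X_{Fin m}]` with `V(η) = V(I·R[X_{Fin m}])` ⟹ the STRONG⁺ confined
iso-step ∃-clause of `stub_confinedIsoStepStrongPlus` for `Spec R[X_{Fin m}]` at `η`, realised by `Bl_{I R[X_{Fin m}]} = Bl_I × 𝔸^m`.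
Every field, every residue field. [folklore] -/
theorem strongPlusStep_cylinder_of_pointModel_fin (p : ℕ) [Fact p.Prime] (R : Type) [CommRing R] [IsDomain R]
    [IsNoetherianRing R] [CharP R p] (I : Ideal R) (hI0 : I ≠ ⊥)
    (hBl : ∀ y : ↥(affineBlowup I), IsDomain ((affineBlowup I).presheaf.stalk y) ∧
      ∀ d : ℕ, ringKrullDim ((affineBlowup I).presheaf.stalk y) = d →
        ∀ s : Fin d → (affineBlowup I).presheaf.stalk y, (Ideal.span (Set.range s)).radical.IsMaximal →
          RingTheory.Sequence.IsWeaklyRegular ((affineBlowup I).presheaf.stalk y) (List.ofFn s) ∧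
          ∀ z : (affineBlowup I).presheaf.stalk y, (∃ e : ℕ, z ^ p ^ e ∈
              Ideal.span ((fun w : (affineBlowup I).presheaf.stalk y => w ^ p ^ e) ''
                (Ideal.span (Set.range s) : Set ((affineBlowup I).presheaf.stalk y)))) →
            z ∈ Ideal.span (Set.range s))
    (m : ℕ) (η : ↥(Spec (.of (MvPolynomial (Fin m) R))))
    (hsupp : ∀ (P : Ideal (MvPolynomial (Fin m) R)) [P.IsPrime],
      I.map (MvPolynomial.C : R →+* MvPolynomial (Fin m) R) ≤ P ↔ η.asIdeal ≤ P) :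
    ∃ (X₂ : Scheme.{0}) (π : X₂ ⟶ Spec (.of (MvPolynomial (Fin m) R))), IsProper π ∧
      Literature.AlgebraicGeometry.Resolution.IsBirational π ∧
      IsIntegral X₂ ∧ (∀ x : X₂, (∀ d : ℕ, ringKrullDim (X₂.presheaf.stalk x) = d → ∀ s : Fin d → X₂.presheaf.stalk x, (Ideal.span (Set.range s)).radical.IsMaximal → RingTheory.Sequence.IsWeaklyRegular (X₂.presheaf.stalk x) (List.ofFn s))) ∧
      IsIso (π ∣_ ⟨(closure ({η} : Set ↥(Spec (.of (MvPolynomial (Fin m) R)))))ᶜ, isClosed_closure.isOpen_compl⟩) ∧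
      ∀ x : X₂, π.base x ∈ closure ({η} : Set ↥(Spec (.of (MvPolynomial (Fin m) R)))) → ¬ IsClosed ({x} : Set X₂) → (IsDomain (X₂.presheaf.stalk x) ∧ ∀ d : ℕ, ringKrullDim (X₂.presheaf.stalk x) = d → ∀ s : Fin d → X₂.presheaf.stalk x, (Ideal.span (Set.range s)).radical.IsMaximal → RingTheory.Sequence.IsWeaklyRegular (X₂.presheaf.stalk x) (List.ofFn s) ∧ ∀ t : X₂.presheaf.stalk x, (∃ e : ℕ, t ^ p ^ e ∈ Ideal.span ((fun z : X₂.presheaf.stalk x => z ^ p ^ e) '' (Ideal.span (Set.range s) : Set (X₂.presheaf.stalk x)))) → t ∈ Ideal.span (Set.range s)) := by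
  have hI' : I.map (MvPolynomial.C : R →+* MvPolynomial (Fin m) R) ≠ ⊥ := fun h =>
    hI0 ((Ideal.map_eq_bot_iff_of_injective (MvPolynomial.C_injective (Fin m) R)).mp h)
  exact StrongPlusStepOfAffineBlowup.strongPlusStep_of_affineBlowup p (MvPolynomial (Fin m) R)
    (I.map (MvPolynomial.C : R →+* MvPolynomial (Fin m) R)) hI' η hsupp (affineBlowup_fiClause_mvPolynomial p R I hBl m)

/-- The same with the generic point of `V(I·R[X_{Fin m}])` supplied from `√(I·R[X_{Fin m}]) = η`. [folklore] -/
theorem strongPlusStep_cylinder_of_pointModel_fin_of_radical_eq (p : ℕ) [Fact p.Prime] (R : Type) [CommRing R] [IsDomain R]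
    [IsNoetherianRing R] [CharP R p] (I : Ideal R) (hI0 : I ≠ ⊥)
    (hBl : ∀ y : ↥(affineBlowup I), IsDomain ((affineBlowup I).presheaf.stalk y) ∧
      ∀ d : ℕ, ringKrullDim ((affineBlowup I).presheaf.stalk y) = d →
        ∀ s : Fin d → (affineBlowup I).presheaf.stalk y, (Ideal.span (Set.range s)).radical.IsMaximal →
          RingTheory.Sequence.IsWeaklyRegular ((affineBlowup I).presheaf.stalk y) (List.ofFn s) ∧
          ∀ z : (affineBlowup I).presheaf.stalk y, (∃ e : ℕ, z ^ p ^ e ∈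
              Ideal.span ((fun w : (affineBlowup I).presheaf.stalk y => w ^ p ^ e) ''
                (Ideal.span (Set.range s) : Set ((affineBlowup I).presheaf.stalk y)))) →
            z ∈ Ideal.span (Set.range s))
    (m : ℕ) (η : ↥(Spec (.of (MvPolynomial (Fin m) R))))
    (hrad : (I.map (MvPolynomial.C : R →+* MvPolynomial (Fin m) R)).radical = η.asIdeal) :
    ∃ (X₂ : Scheme.{0}) (π : X₂ ⟶ Spec (.of (MvPolynomial (Fin m) R))), IsProper π ∧
      Literature.AlgebraicGeometry.Resolution.IsBirational π ∧
      IsIntegral X₂ ∧ (∀ x : X₂, (∀ d : ℕ, ringKrullDim (X₂.presheaf.stalk x) = d → ∀ s : Fin d → X₂.presheaf.stalk x, (Ideal.span (Set.range s)).radical.IsMaximal → RingTheory.Sequence.IsWeaklyRegular (X₂.presheaf.stalk x) (List.ofFn s))) ∧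
      IsIso (π ∣_ ⟨(closure ({η} : Set ↥(Spec (.of (MvPolynomial (Fin m) R)))))ᶜ, isClosed_closure.isOpen_compl⟩) ∧
      ∀ x : X₂, π.base x ∈ closure ({η} : Set ↥(Spec (.of (MvPolynomial (Fin m) R)))) → ¬ IsClosed ({x} : Set X₂) → (IsDomain (X₂.presheaf.stalk x) ∧ ∀ d : ℕ, ringKrullDim (X₂.presheaf.stalk x) = d → ∀ s : Fin d → X₂.presheaf.stalk x, (Ideal.span (Set.range s)).radical.IsMaximal → RingTheory.Sequence.IsWeaklyRegular (X₂.presheaf.stalk x) (List.ofFn s) ∧ ∀ t : X₂.presheaf.stalk x, (∃ e : ℕ, t ^ p ^ e ∈ Ideal.span ((fun z : X₂.presheaf.stalk x => z ^ p ^ e) '' (Ideal.span (Set.range s) : Set (X₂.presheaf.stalk x)))) → t ∈ Ideal.span (Set.range s)) :=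
  strongPlusStep_cylinder_of_pointModel_fin p R I hI0 hBl m η
    (fun P _ => StrongPlusStepOfAffineBlowup.supp_iff_of_radical_eq (I.map (MvPolynomial.C : R →+* MvPolynomial (Fin m) R)) η hrad P)

end Summit.ResolutionOfSingularities.ResolutionOfSingularities.Theorems.FInjectiveMacaulayfication.CylinderOfPointModelFin

end
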